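import Summits.Langlands.Langlands.Theses.SkinnerWilesDefectOne

/-!
# Route SkinnerWilesDefectOne — glue to the target (`ModularOfProModularClassical`)

The support item (stmt-Langlands-14468) of route `SkinnerWilesDefectOne` for the Langlands summit:
`ReducibleOrdinaryProModular → ProModularOrdinaryClassical → ReducibleOrdinaryModular`.

This is pure logic over the item signatures (the body of the route file's deciding theorem
`Summit.Langlands.Langlands.Theses.SkinnerWilesDefectOne.closes`, minus its `SectorComplement`
step): fix the binders `(F, p, O, hcpt, ι, ρ, ρ₀)` and hypotheses of the target
`ReducibleOrdinaryModular`; the engine `ReducibleOrdinaryProModular` (Skinner–Wiles pro-modularity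
at Taylor–Wiles defect one) yields a tame level `𝒰` with `𝒰.IsPadicallyAutomorphic ρ`; from the
target's local clause at `v ∣ p` drop `IsPDistinguishedAt ρ₀ v` and the orientation inequality
`‖Q₀₀‖ ≤ ‖Q₁₀‖`, and repackage the ordinary frame `Q` as `ρ.IsOrdinaryOfWeightAt p v k m` via
`Literature.NumberTheory.GaloisRepresentations.FramedGaloisRep.isOrdinaryOfWeightAt_iff_padicAlgCl`;
the exit `ProModularOrdinaryClassical` (Hida control / classicality) then yields the `L`-algebraic
cuspidal `π` with cofinite `SatakeFrobCompatibleAt`.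
-/

set_option linter.dupNamespace false -- project-wide option (lakefile weak.linter.dupNamespace); `Summit.Langlands.Langlands` is the mandated namespace

namespace Summit.Langlands.Langlands.Theorems

/-- **Glue to the target of route SkinnerWilesDefectOne.**
`ReducibleOrdinaryProModular → ProModularOrdinaryClassical → ReducibleOrdinaryModular`:
pro-modularity (engine) and classicality of pro-modular ordinary representations (exit) imply the
sector theorem — Skinner–Wiles Theorem A transposed to an imaginary quadratic field. Proof: unfold,
introduce the target's binders and hypotheses, obtain `∃ 𝒰, 𝒰.IsPadicallyAutomorphic ρ` from the
engine, forget `IsPDistinguishedAt` and the orientation conjunct of the local clause, repackage the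
frame with `FramedGaloisRep.isOrdinaryOfWeightAt_iff_padicAlgCl`, and apply the exit. -/
theorem skinnerWilesDefectOne_modularOfProModularClassical_proof :
    Summit.Langlands.Langlands.Theses.SkinnerWilesDefectOne.ModularOfProModularClassical := by
  unfold Summit.Langlands.Langlands.Theses.SkinnerWilesDefectOne.ModularOfProModularClassical
  intro h₁ h₂ F _ _ hF hdeg p _ hp O hO hcpt ι ρ ρ₀ hirr hunr hmod hloc
  refine h₂ F hF hdeg p hp hcpt ι ρ hirr hunr (h₁ F hF hdeg p hp O hO ρ ρ₀ hirr hunr hmod hloc) ?_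
  obtain ⟨k, hk, m, hm, hv⟩ := hloc
  refine ⟨k, hk, m, hm, fun v hpv => ?_⟩
  obtain ⟨-, Q, -, hQ⟩ := hv v hpv
  exact (Literature.NumberTheory.GaloisRepresentations.FramedGaloisRep.isOrdinaryOfWeightAt_iff_padicAlgCl
    p ρ v k m).mpr ⟨Q, hQ⟩

end Summit.Langlands.Langlands.Theorems
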